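import Summits.HubbardSuperconductivity.HubbardSuperconductivity.Theorems.AnisotropyChordFourTorusCore

/-!
# Route `AnisotropyChord` / crux `FerroSideChord` at `M = 4`: KERNEL-EVALUATED symmetry bookkeeping of the `4 × 4` torus, II —
# the weight-9 codes (prover seat `hubbard-h0-rotor-p1` g17)

`check9_lo/hi` — every weight-9 code `k < 2^16` has `cls9 k < 56`, an EVEN witness `wit9 k < 768` (a graph automorphism, no
spin flip) with `actCode (wit9 k) (rep9 (cls9 k)) = k`; `counts9_eq` — the class counts (17-bit fields); `rep9_spec` — the
representatives are weight-9 codes of their own class whose 9 children (one particle removed) are weight-8 codes.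
-/

set_option linter.style.longLine false
set_option linter.dupNamespace false
set_option autoImplicit false

namespace Summit.HubbardSuperconductivity.HubbardSuperconductivity.Theorems.AnisotropyChord.FourTorus

/-- witness check for one weight-9 code. [folklore] -/
def ok9 (k : ℕ) : Bool :=
  !(pop16 k == 9) || (decide (cls9 k < 56) && decide (wit9 k < 768) && (wit9 k % 2 == 0) &&
    (actCode (wit9 k) (rep9 (cls9 k)) == k))
/-- packed class indicator of a weight-9 code (17-bit fields), `0` off the sector. [folklore] -/
def ind9 (k : ℕ) : ℕ := bif pop16 k == 9 then 2 ^ (17 * cls9 k) else 0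
/-- literal: class counts, weight 9 (17-bit fields). [folklore] -/
def counts9Lit : ℕ := 0x80010000600060006000180008000c0002000180018000c0006000300030000c000c000300018000c000300030001800180006000100030000c000c00060003000180006000300008000c0003000180030000c0006000300030000c000c0000c001800180006000300018000c000600030003000040
/-- size of the weight-9 class `ρ`. [folklore] -/
def n9 (r : ℕ) : ℕ := field 17 counts9Lit r

/-- every weight-9 code `< 2^15` carries a checked (even) symmetry witness. [folklore] -/
theorem check9_lo : allHalf 0 ok9 = true := by decide +kernel
/-- every weight-9 code `≥ 2^15` carries a checked (even) symmetry witness. [folklore] -/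
theorem check9_hi : allHalf 1 ok9 = true := by decide +kernel
/-- the weight-9 class counts. [folklore] -/
theorem counts9_eq : sum16 ind9 = counts9Lit := by decide +kernel
/-- representatives are weight-9 codes of their own class; removing any particle gives a weight-8 code. [folklore] -/
theorem rep9_spec : allN 56 (fun r => (pop16 (rep9 r) == 9) && (cls9 (rep9 r) == r) && decide (rep9 r < 65536) &&
    allN 16 fun i => !(Nat.testBit (rep9 r) i) || ((pop16 (rep9 r ^^^ 2 ^ i) == 8) && decide (rep9 r ^^^ 2 ^ i < 65536))) = true := by
  decide +kernel

end Summit.HubbardSuperconductivity.HubbardSuperconductivity.Theorems.AnisotropyChord.FourTorus
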